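import Mathlib
import Summits.NavierStokesRegularity.NavierStokesRegularity.Theorems.EulerZoomLiouvillePowerGaugeEulerLiouvilleMirrorMomentLayer
import HarnessLib

/-!
# Crux `EulerZoomLiouville.PowerGaugeEulerLiouville` (stmt-NavierStokesRegularity-19832), line `mirror-moment`, stub M1 — time side, part 3c-ii:
# THE WEIGHTED LEDGER MOMENT `∫ (1+‖x‖)|Ω|` IS LOCALLY BOUNDED IN TIME, and M1 `stub_momentMonotone` UNCONDITIONALLY

Route №10 `EulerZoomLiouville` (NavierStokesRegularity), crux E (`PowerGaugeEulerLiouville`).  Line `mirror-moment` (ideator ns-idea-11 g3;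
`Cruxes/PowerGaugeEulerLiouville/Lines/mirror_moment.lean`), lever **M1 `stub_momentMonotone`**: for a flow of the stratum `IsMirrorOutgoingWith u p R₀ β`
the axial moment `M(τ) = ∫ |x₃| η(τ,x) dx` (`η = ‖curl u‖/r`) is non-decreasing on `τ < 0`.  Seat ns-sfl-p1 g3 (LEAD key ns-typeII-p2 g10
09:38:57Z / g11 10:28:47Z (c)).

Part 2 (`…MirrorMomentMonotone`, `momentMonotone_of_mirrorOutgoingWith_of_ledgerBound`) proved M1 from ONE extra clause `hN`: the weighted ledger
moment `∫ (1+‖x‖) η(τ)` is bounded on compact time intervals.  This file DISCHARGES `hN` from the stratum predicate itself: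

* `ledgerBound_slab` — for a classical swirl-free axisymmetric Euler flow on `[0,T]` with `|v| ≤ B`, the outgoing sign `x₃ ω_θ ≥ 0` and
  `(1+‖x‖)|Ω(σ)| ∈ L¹` slice by slice:  **`∫ (1+‖x‖)|Ω(T)| ≤ 2(1+BT) ∫ (1+‖x‖)|Ω(0)|`**.  Proof: the moving weight
  `Z = Ψ_R((⟨x⟩+Bσ)/R)·(⟨x⟩+B(T−σ))·s_δ(x₃)` is a supersolution of the transport `∂ₜΩ + v·∇Ω = 0` up to the sign layer (parts 3b, 3c-i:
  `integral_weightZ_slab_le`), the layer costs `O(δ)` (`volumeReal_layerBox_le`, `|Ω| ≤ L|x₃|` — ns-ezl-w2's plane vanishing), then `δ → 0`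
  (`tendsto_integral_oddSwitch_mul_angVortQuot`) and `R → ∞` (`tendsto_integral_plateau_mul`), and `1+‖x‖ ≤ 2⟨x⟩`, `⟨x⟩+BT ≤ (1+BT)(1+‖x‖)`;
* `ledgerBound_of_mirrorOutgoingWith` — the clause `hN` of part 2 for every flow of the stratum (time shift to `[0, τ−T₁]`, `|Ω| = η` a.e.);
* `momentMonotone_of_mirrorOutgoingWith` — **M1 = `Sig.stub_momentMonotone` of `Lines/mirror_moment.lean` with `IsMirrorOutgoingWith` and
  `MomentMonotone` UNFOLDED VERBATIM, UNCONDITIONAL**: part 2 + `ledgerBound_of_mirrorOutgoingWith`.  With ns-ezl-w2's member corollary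
  `mirrorOutgoing_ae_eq_zero_of_momentMonotone` (`…MirrorMomentMember`, whose hypothesis `hM1` is literally this theorem) the stratum is killed.

WHAT THIS IS NOT: not NS regularity, not the crux E (19832 stays OPEN; the LEAD's skeleton of record is untouched) — ONE registered line stub,
`--supports` stmt-19832.  [cite: MajdaBertozziCUP2002, §2.3.3 (vorticity transport `D(ω_θ/r)/Dt = 0` for axisymmetric swirl-free Euler);
cite: ChoiJeong2025, §1–§3 (anti-parallel vortex rings: the sign `x₃ ω_θ`, monotone axial moments — here time-reversed); folklore (moving-weight
energy method)]
-/

noncomputable section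

-- flat `Theorems/<Route><Decl>…` files of one crux share the namespace of the crux (tree convention)
set_option linter.dupNamespace false

open MeasureTheory Set Filter Topology Metric Function
open scoped NNReal ENNReal RealInnerProductSpace

namespace Summit.NavierStokesRegularity.NavierStokesRegularity.Theorems.PowerGaugeEulerLiouville.MirrorMoment

open Literature.Analysis Literature.Analysis.FluidPDE

/-! ### The uniform bound on a slab -/

/-- **The weighted ledger moment is controlled by its initial value on a slab.**  For a classical swirl-free axisymmetric Euler flow `v` on
`[0,T]` (`T > 0`) with `‖v‖ ≤ B`, the outgoing sign `0 ≤ x₃ · swirl(curl v)` and `(1+‖x‖)|Ω(σ)| ∈ L¹` for every slice (`Ω = ω_θ/r`):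
`∫ (1+‖x‖)|Ω(T,x)| dx ≤ 2(1+BT) ∫ (1+‖x‖)|Ω(0,x)| dx`.
[cite: MajdaBertozziCUP2002, §2.3.3 (2.58); folklore (moving-weight supersolution, sign layer `O(δ)`, dominated convergence)] -/
theorem ledgerBound_slab {T : ℝ} (hT : 0 < T)
    {v : ℝ → EuclideanSpace ℝ (Fin 3) → EuclideanSpace ℝ (Fin 3)} {q : ℝ → EuclideanSpace ℝ (Fin 3) → ℝ}
    (hv : IsClassicalNSSolutionOn (Icc 0 T) 0 0 v q)
    (hax : ∀ σ ∈ Icc 0 T, IsAxisymmetric (v σ)) (hsw : ∀ σ ∈ Icc 0 T, HasNoSwirl (v σ))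
    (hout : ∀ σ ∈ Icc 0 T, ∀ y : EuclideanSpace ℝ (Fin 3), 0 ≤ y 2 * swirl (curl (v σ)) y)
    {B : ℝ} (hB0 : 0 ≤ B) (hB : ∀ σ ∈ Icc 0 T, ∀ y : EuclideanSpace ℝ (Fin 3), ‖v σ y‖ ≤ B)
    (hint : ∀ σ ∈ Icc 0 T, Integrable fun x : EuclideanSpace ℝ (Fin 3) => (1 + ‖x‖) * |angVortQuot (v σ) x|) :
    ∫ x : EuclideanSpace ℝ (Fin 3), (1 + ‖x‖) * |angVortQuot (v T) x| ≤
      2 * (1 + B * T) * ∫ x : EuclideanSpace ℝ (Fin 3), (1 + ‖x‖) * |angVortQuot (v 0) x| := by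
  obtain ⟨D, -, hD⟩ := Literature.Analysis.Calculus.exists_bound_deriv_smoothTransition
  have h0I : (0 : ℝ) ∈ Icc 0 T := ⟨le_rfl, hT.le⟩
  have hTI : T ∈ Icc 0 T := ⟨hT.le, le_rfl⟩
  have hv3 : ∀ σ ∈ Icc 0 T, ContDiff ℝ 3 (v σ) := fun σ hσ => (hv.contDiff_velocity hσ).of_le (by norm_cast)
  have hBT : 0 ≤ B * T := mul_nonneg hB0 hT.le
  have hbc : Continuous fun x : EuclideanSpace ℝ (Fin 3) => Real.sqrt (1 + ‖x‖ ^ 2) := (contDiff_bracket (n := 0)).continuous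
  -- Step 1: for every `R > 0`, `∫ Ψ_R(T) ⟨x⟩ |Ω(T)| ≤ (1+BT) ∫ (1+‖x‖)|Ω(0)|`
  have hstep : ∀ R : ℝ, 0 < R → ∫ x : EuclideanSpace ℝ (Fin 3),
      Real.smoothTransition (2 - (Real.sqrt (1 + ‖x‖ ^ 2) + B * T) / R) * Real.sqrt (1 + ‖x‖ ^ 2) * |angVortQuot (v T) x| ≤
        (1 + B * T) * ∫ x : EuclideanSpace ℝ (Fin 3), (1 + ‖x‖) * |angVortQuot (v 0) x| := by
    intro R hR
    obtain ⟨L, hL0, hL⟩ := exists_abs_angVortQuot_le_mul_slab hT hv.smooth_velocity hax hout (2 * R)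
    -- the profiles at `σ = T` and `σ = 0`
    have hPc : ∀ σ : ℝ, Continuous fun x : EuclideanSpace ℝ (Fin 3) => (Real.smoothTransition (2 - (Real.sqrt (1 + ‖x‖ ^ 2) + B * σ) / R) * (Real.sqrt (1 + ‖x‖ ^ 2) + B * (T - σ))) := fun σ =>
      (Real.smoothTransition.continuous.comp (continuous_const.sub ((hbc.add continuous_const).div_const _))).mul (hbc.add continuous_const)
    have hP0 : ∀ σ ∈ Icc 0 T, ∀ x : EuclideanSpace ℝ (Fin 3), 0 ≤ (Real.smoothTransition (2 - (Real.sqrt (1 + ‖x‖ ^ 2) + B * σ) / R) * (Real.sqrt (1 + ‖x‖ ^ 2) + B * (T - σ))) := fun σ hσ x => (profile_bounds (T := T) hB0 hσ.1 hσ.2 hR x).1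
    have hPC : ∀ σ ∈ Icc 0 T, ∀ x : EuclideanSpace ℝ (Fin 3), (Real.smoothTransition (2 - (Real.sqrt (1 + ‖x‖ ^ 2) + B * σ) / R) * (Real.sqrt (1 + ‖x‖ ^ 2) + B * (T - σ))) ≤ 2 * R + B * T := fun σ hσ x => (profile_bounds (T := T) hB0 hσ.1 hσ.2 hR x).2.1
    -- the estimate at `δ = 1/(n+1)` and its two limits
    have hn : ∀ n : ℕ, ∫ x : EuclideanSpace ℝ (Fin 3), (Real.smoothTransition (2 - (Real.sqrt (1 + ‖x‖ ^ 2) + B * T) / R) * (Real.sqrt (1 + ‖x‖ ^ 2) + B * (T - T)) * (Real.smoothTransition (x 2 / (1 / ((n : ℝ) + 1))) - Real.smoothTransition (-(x 2) / (1 / ((n : ℝ) + 1))))) * angVortQuot (v T) x ≤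
        (∫ x : EuclideanSpace ℝ (Fin 3), (Real.smoothTransition (2 - (Real.sqrt (1 + ‖x‖ ^ 2) + B * 0) / R) * (Real.sqrt (1 + ‖x‖ ^ 2) + B * (T - 0)) * (Real.smoothTransition (x 2 / (1 / ((n : ℝ) + 1))) - Real.smoothTransition (-(x 2) / (1 / ((n : ℝ) + 1))))) * angVortQuot (v 0) x) +
          T * (volume.real (closedBall (0 : EuclideanSpace ℝ (Fin 3)) (2 * R) ∩ {y | |y 2| ≤ 1 / ((n : ℝ) + 1)}) * (2 * B * (2 * R + B * T) * D * L)) :=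
      fun n => integral_weightZ_slab_le hT hv hax hsw hout hB0 hB hR (by positivity) hD hL0 hL
    have hlimT := tendsto_integral_oddSwitch_mul_angVortQuot (hv3 T hTI) (hax T hTI) (hsw T hTI) (hout T hTI) (hint T hTI) (hPc T) (hP0 T hTI) (hPC T hTI)
    have hlim0 := tendsto_integral_oddSwitch_mul_angVortQuot (hv3 0 h0I) (hax 0 h0I) (hsw 0 h0I) (hout 0 h0I) (hint 0 h0I) (hPc 0) (hP0 0 h0I) (hPC 0 h0I)
    have herr : Tendsto (fun n : ℕ => T * (volume.real (closedBall (0 : EuclideanSpace ℝ (Fin 3)) (2 * R) ∩ {y | |y 2| ≤ 1 / ((n : ℝ) + 1)}) *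
        (2 * B * (2 * R + B * T) * D * L))) atTop (𝓝 0) := by
      have hD0 : 0 ≤ D := (abs_nonneg _).trans (hD 0)
      have hT0 := hT.le
      refine squeeze_zero (g := fun n : ℕ => T * (8 * (2 * R) ^ 2 * (1 / ((n : ℝ) + 1)) * (2 * B * (2 * R + B * T) * D * L)))
        (fun n => by positivity) (fun n => ?_) ?_
      · have hv' := volumeReal_layerBox_le (ρ := 2 * R) (by positivity) (show (0 : ℝ) ≤ 1 / ((n : ℝ) + 1) by positivity)
        dsimp only
        gcongr
      · have h := (tendsto_one_div_add_atTop_nhds_zero_nat (𝕜 := ℝ)).const_mul (T * (8 * (2 * R) ^ 2) * (2 * B * (2 * R + B * T) * D * L))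
        rw [mul_zero] at h
        refine h.congr fun n => ?_
        ring
    have hle := le_of_tendsto_of_tendsto' hlimT (hlim0.add herr) hn
    rw [add_zero] at hle
    -- `P(0,x) ≤ (1+BT)(1+‖x‖)`
    have h0 : ∫ x : EuclideanSpace ℝ (Fin 3), (Real.smoothTransition (2 - (Real.sqrt (1 + ‖x‖ ^ 2) + B * 0) / R) * (Real.sqrt (1 + ‖x‖ ^ 2) + B * (T - 0))) * |angVortQuot (v 0) x| ≤
        (1 + B * T) * ∫ x : EuclideanSpace ℝ (Fin 3), (1 + ‖x‖) * |angVortQuot (v 0) x| := by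
      rw [← integral_const_mul]
      refine integral_mono_of_nonneg (Eventually.of_forall fun x => mul_nonneg (hP0 0 h0I x) (abs_nonneg _)) ((hint 0 h0I).const_mul _)
        (Eventually.of_forall fun x => ?_)
      obtain ⟨hb1, -, hle'⟩ := bracket_bounds x
      have hP1 : (Real.smoothTransition (2 - (Real.sqrt (1 + ‖x‖ ^ 2) + B * 0) / R) * (Real.sqrt (1 + ‖x‖ ^ 2) + B * (T - 0))) ≤ (1 + B * T) * (1 + ‖x‖) := by
        calc (Real.smoothTransition (2 - (Real.sqrt (1 + ‖x‖ ^ 2) + B * 0) / R) * (Real.sqrt (1 + ‖x‖ ^ 2) + B * (T - 0))) ≤ 1 * (Real.sqrt (1 + ‖x‖ ^ 2) + B * (T - 0)) :=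
              mul_le_mul_of_nonneg_right (Real.smoothTransition.le_one _) (by nlinarith)
          _ ≤ (1 + B * T) * (1 + ‖x‖) := by nlinarith [norm_nonneg x]
      calc (Real.smoothTransition (2 - (Real.sqrt (1 + ‖x‖ ^ 2) + B * 0) / R) * (Real.sqrt (1 + ‖x‖ ^ 2) + B * (T - 0))) * |angVortQuot (v 0) x| ≤ (1 + B * T) * (1 + ‖x‖) * |angVortQuot (v 0) x| :=
            mul_le_mul_of_nonneg_right hP1 (abs_nonneg _)
        _ = (1 + B * T) * ((1 + ‖x‖) * |angVortQuot (v 0) x|) := by ring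
    -- `P(T,x) = Ψ_R(T,x) ⟨x⟩`
    have hTT : (fun x : EuclideanSpace ℝ (Fin 3) => (Real.smoothTransition (2 - (Real.sqrt (1 + ‖x‖ ^ 2) + B * T) / R) * (Real.sqrt (1 + ‖x‖ ^ 2) + B * (T - T))) * |angVortQuot (v T) x|) = fun x =>
        Real.smoothTransition (2 - (Real.sqrt (1 + ‖x‖ ^ 2) + B * T) / R) * Real.sqrt (1 + ‖x‖ ^ 2) * |angVortQuot (v T) x| := by
      funext x; rw [sub_self, mul_zero, add_zero]
    rw [hTT] at hle
    exact hle.trans h0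
  -- Step 2: `R = n + 1 → ∞`
  have hlimR := tendsto_integral_plateau_mul (hv3 T hTI) (hint T hTI) (B * T)
  have hbr : ∫ x : EuclideanSpace ℝ (Fin 3), Real.sqrt (1 + ‖x‖ ^ 2) * |angVortQuot (v T) x| ≤
      (1 + B * T) * ∫ x : EuclideanSpace ℝ (Fin 3), (1 + ‖x‖) * |angVortQuot (v 0) x| :=
    le_of_tendsto' hlimR fun n => hstep ((n : ℝ) + 1) (by positivity)
  -- Step 3: `1 + ‖x‖ ≤ 2⟨x⟩`
  have hΩc : Continuous (angVortQuot (v T)) := continuous_angVortQuot (hv3 T hTI)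
  have hbi : Integrable fun x : EuclideanSpace ℝ (Fin 3) => Real.sqrt (1 + ‖x‖ ^ 2) * |angVortQuot (v T) x| := by
    refine (hint T hTI).mono' ((hbc.mul hΩc.abs).aestronglyMeasurable) (Eventually.of_forall fun x => ?_)
    obtain ⟨hb1, -, hle⟩ := bracket_bounds x
    rw [Real.norm_of_nonneg (mul_nonneg (by linarith) (abs_nonneg _))]
    exact mul_le_mul_of_nonneg_right hle (abs_nonneg _)
  calc ∫ x : EuclideanSpace ℝ (Fin 3), (1 + ‖x‖) * |angVortQuot (v T) x|
      ≤ ∫ x : EuclideanSpace ℝ (Fin 3), 2 * (Real.sqrt (1 + ‖x‖ ^ 2) * |angVortQuot (v T) x|) := by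
        refine integral_mono_of_nonneg (Eventually.of_forall fun x => mul_nonneg (by positivity) (abs_nonneg _)) (hbi.const_mul 2)
          (Eventually.of_forall fun x => ?_)
        obtain ⟨hb1, hle, -⟩ := bracket_bounds x
        have h2 : 1 + ‖x‖ ≤ 2 * Real.sqrt (1 + ‖x‖ ^ 2) := by linarith
        calc (1 + ‖x‖) * |angVortQuot (v T) x| ≤ 2 * Real.sqrt (1 + ‖x‖ ^ 2) * |angVortQuot (v T) x| :=
              mul_le_mul_of_nonneg_right h2 (abs_nonneg _)
          _ = 2 * (Real.sqrt (1 + ‖x‖ ^ 2) * |angVortQuot (v T) x|) := by ring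
    _ = 2 * ∫ x : EuclideanSpace ℝ (Fin 3), Real.sqrt (1 + ‖x‖ ^ 2) * |angVortQuot (v T) x| := integral_const_mul _ _
    _ ≤ 2 * ((1 + B * T) * ∫ x : EuclideanSpace ℝ (Fin 3), (1 + ‖x‖) * |angVortQuot (v 0) x|) := by gcongr
    _ = 2 * (1 + B * T) * ∫ x : EuclideanSpace ℝ (Fin 3), (1 + ‖x‖) * |angVortQuot (v 0) x| := by ring

/-! ### The clause `hN` of part 2, for every flow of the stratum -/

/-- **The weighted ledger moment of a mirror-outgoing flow is bounded on compact past time intervals** — the clause `hN` of part 2's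
`momentMonotone_of_mirrorOutgoingWith_of_ledgerBound`, derived from the stratum predicate (`IsMirrorOutgoingWith u p R₀ β` of
`Lines/mirror_moment.lean`, unfolded): on `[T, T']`, `∫ (1+‖x‖) η(τ) ≤ 2(1 + B(T'−T)) ∫ (1+‖x‖) η(T)` with `B` the velocity bound of the
stratum on `[T, T']` (`ledgerBound_slab` after the time shift `σ ↦ σ + T`; `η = |Ω|` a.e., `axisLedger_dictionary`). [folklore] -/
theorem ledgerBound_of_mirrorOutgoingWith
    (u : ℝ → EuclideanSpace ℝ (Fin 3) → EuclideanSpace ℝ (Fin 3)) (p : ℝ → EuclideanSpace ℝ (Fin 3) → ℝ) (R₀ β : ℝ)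
    (h : IsClassicalEulerSolutionOn (Set.Iio 0) 0 u p ∧
        (∀ τ : ℝ, τ < 0 → IsAxisymmetric (u τ) ∧ HasNoSwirl (u τ)) ∧
        (∀ τ : ℝ, τ < 0 → ∀ x : EuclideanSpace ℝ (Fin 3),
          u τ (x - (2 * x 2) • (eZ : EuclideanSpace ℝ (Fin 3))) = u τ x - (2 * u τ x 2) • (eZ : EuclideanSpace ℝ (Fin 3))) ∧
        (∀ τ : ℝ, τ < 0 → ∀ x : EuclideanSpace ℝ (Fin 3), 0 ≤ x 2 * swirl (curl (u τ)) x) ∧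
        0 ≤ R₀ ∧ 0 ≤ β ∧
        (∀ τ : ℝ, τ < 0 → ∀ x : EuclideanSpace ℝ (Fin 3), R₀ * (1 + -τ) ^ β < cylRadius x → curl (u τ) x = 0) ∧
        (∀ τ : ℝ, τ < 0 →
          Integrable (fun x : EuclideanSpace ℝ (Fin 3) => (1 + ‖x‖) * ‖u τ x‖ ^ 2) ∧
            Integrable (fun x : EuclideanSpace ℝ (Fin 3) => (1 + ‖x‖) * (‖curl (u τ) x‖ / cylRadius x))) ∧
        (∀ T T' : ℝ, T ≤ T' → T' < 0 → ∃ B : ℝ, ∀ τ ∈ Set.Icc T T', ∀ x : EuclideanSpace ℝ (Fin 3), ‖u τ x‖ ≤ B)) :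
    ∀ T T' : ℝ, T ≤ T' → T' < 0 → ∃ K : ℝ, ∀ τ ∈ Set.Icc T T',
      ∫ x : EuclideanSpace ℝ (Fin 3), (1 + ‖x‖) * (‖curl (u τ) x‖ / cylRadius x) ≤ K := by
  intro T₁ T₂ h12 hT₂
  obtain ⟨hcl, hsym, -, hout, -, -, -, hint, hbdd⟩ := h
  obtain ⟨B, hB⟩ := hbdd T₁ T₂ h12 hT₂
  have hT₁ : T₁ < 0 := lt_of_le_of_lt h12 hT₂
  have hB0 : 0 ≤ B := (norm_nonneg _).trans (hB T₁ ⟨le_rfl, h12⟩ 0)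
  have hI0 : 0 ≤ ∫ x : EuclideanSpace ℝ (Fin 3), (1 + ‖x‖) * (‖curl (u T₁) x‖ / cylRadius x) :=
    integral_nonneg fun x => mul_nonneg (by positivity) (div_nonneg (norm_nonneg _) (cylRadius_nonneg x))
  refine ⟨2 * (1 + B * (T₂ - T₁)) * ∫ x : EuclideanSpace ℝ (Fin 3), (1 + ‖x‖) * (‖curl (u T₁) x‖ / cylRadius x), fun τ hτ => ?_⟩
  have hK1 : 1 ≤ 2 * (1 + B * (T₂ - T₁)) := by nlinarith [mul_nonneg hB0 (sub_nonneg.2 h12)]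
  rcases hτ.1.eq_or_lt with heq | hlt
  · rw [← heq]
    exact le_mul_of_one_le_left hI0 hK1
  -- the shifted flow on `[0, τ − T₁]`
  have hτ0 : τ < 0 := lt_of_le_of_lt hτ.2 hT₂
  have hT : 0 < τ - T₁ := sub_pos.2 hlt
  have hsub : Icc 0 (τ - T₁) ⊆ (fun σ : ℝ => σ + T₁) ⁻¹' Set.Iio (0 : ℝ) := by
    intro σ hσ
    show σ + T₁ < 0
    linarith [hσ.2]
  have hneg : ∀ σ ∈ Icc 0 (τ - T₁), σ + T₁ < 0 := fun σ hσ => hsub hσ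
  have hmem : ∀ σ ∈ Icc 0 (τ - T₁), σ + T₁ ∈ Set.Icc T₁ T₂ := fun σ hσ => ⟨by linarith [hσ.1], by linarith [hσ.2, hτ.2]⟩
  have hv : IsClassicalNSSolutionOn (Icc 0 (τ - T₁)) 0 0 (fun σ => u (σ + T₁)) (fun σ => p (σ + T₁)) :=
    (hcl.comp_add_right T₁).mono hsub (uniqueDiffOn_Icc hT)
  have hsm : ∀ τ' : ℝ, τ' < 0 → ContDiff ℝ 3 (u τ') := fun τ' hτ' =>
    (hcl.contDiff_velocity (show τ' ∈ Set.Iio (0 : ℝ) from hτ')).of_le (by norm_cast)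
  -- `(1+‖x‖) η = (1+‖x‖) |Ω|` a.e. on every past slice
  have hae : ∀ τ' : ℝ, τ' < 0 → (fun x : EuclideanSpace ℝ (Fin 3) => (1 + ‖x‖) * (‖curl (u τ') x‖ / cylRadius x)) =ᵐ[volume]
      fun x => (1 + ‖x‖) * |angVortQuot (u τ') x| := by
    intro τ' hτ'
    filter_upwards [ae_cylRadius_ne_zero] with x hx
    rw [(axisLedger_dictionary (hsm τ' hτ') (hsym τ' hτ').1 (hsym τ' hτ').2 (hout τ' hτ') hx).1]
  have hslab := ledgerBound_slab hT hv (fun σ hσ => (hsym _ (hneg σ hσ)).1) (fun σ hσ => (hsym _ (hneg σ hσ)).2)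
    (fun σ hσ => hout _ (hneg σ hσ)) hB0 (fun σ hσ y => hB _ (hmem σ hσ) y)
    (fun σ hσ => (hint _ (hneg σ hσ)).2.congr (hae _ (hneg σ hσ)))
  simp only [sub_add_cancel, zero_add] at hslab
  rw [integral_congr_ae (hae τ hτ0), integral_congr_ae (hae T₁ hT₁)]
  have hI0' : 0 ≤ ∫ x : EuclideanSpace ℝ (Fin 3), (1 + ‖x‖) * |angVortQuot (u T₁) x| :=
    integral_nonneg fun x => mul_nonneg (by positivity) (abs_nonneg _)
  calc ∫ x : EuclideanSpace ℝ (Fin 3), (1 + ‖x‖) * |angVortQuot (u τ) x|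
      ≤ 2 * (1 + B * (τ - T₁)) * ∫ x : EuclideanSpace ℝ (Fin 3), (1 + ‖x‖) * |angVortQuot (u T₁) x| := hslab
    _ ≤ 2 * (1 + B * (T₂ - T₁)) * ∫ x : EuclideanSpace ℝ (Fin 3), (1 + ‖x‖) * |angVortQuot (u T₁) x| := by
        have hτ2 : τ - T₁ ≤ T₂ - T₁ := by linarith [hτ.2]
        gcongr

/-! ### M1, unconditional -/

/-- **M1 `stub_momentMonotone` (line `mirror-moment`, `Lines/mirror_moment.lean`) — `Sig.stub_momentMonotone` with `IsMirrorOutgoingWith`,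
`MomentMonotone`, `axialMoment`, `axisLedger`, `reflZ` UNFOLDED VERBATIM, UNCONDITIONAL.**  For a classical IsClassicalEulerSolutionOn (Set.Iio 0) 0 u p ∧
        (∀ τ : ℝ, τ < 0 → IsAxisymmetric (u τ) ∧ HasNoSwirl (u τ)) ∧
        (∀ τ : ℝ, τ < 0 → ∀ x : EuclideanSpace ℝ (Fin 3),
          u τ (x - (2 * x 2) • (eZ : EuclideanSpace ℝ (Fin 3))) = u τ x - (2 * u τ x 2) • (eZ : EuclideanSpace ℝ (Fin 3))) ∧
        (∀ τ : ℝ, τ < 0 → ∀ x : EuclideanSpace ℝ (Fin 3), 0 ≤ x 2 * swirl (curl (u τ)) x) ∧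
        0 ≤ R₀ ∧ 0 ≤ β ∧
        (∀ τ : ℝ, τ < 0 → ∀ x : EuclideanSpace ℝ (Fin 3), R₀ * (1 + -τ) ^ β < cylRadius x → curl (u τ) x = 0) ∧
        (∀ τ : ℝ, τ < 0 →
          Integrable (fun x : EuclideanSpace ℝ (Fin 3) => (1 + ‖x‖) * ‖u τ x‖ ^ 2) ∧
            Integrable (fun x : EuclideanSpace ℝ (Fin 3) => (1 + ‖x‖) * (‖curl (u τ) x‖ / cylRadius x))) ∧
        (∀ T T' : ℝ, T ≤ T' → T' < 0 → ∃ B : ℝ, ∀ τ ∈ Set.Icc T T', ∀ x : EuclideanSpace ℝ (Fin 3), ‖u τ x‖ ≤ B)-OUTGOING member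
(`IsClassicalEulerSolutionOn (Iio 0)`, axisymmetric swirl-free slices, mirror-equivariant, outgoing sign `x₃ · (r ω_θ) ≥ 0`, vorticity confined to
`r ≤ R₀(1+(−τ))^β`, finite weighted energy and weighted ledger per slice, velocity bounded on compact past slabs) the axial ledger moment
`M(τ) = ∫ |x₃| ‖curl u(τ,x)‖/r dx` is non-decreasing on `τ < 0`:  part 2 (`momentMonotone_of_mirrorOutgoingWith_of_ledgerBound`: slice sign
`dM/dτ = ∫ u₃ ω_θ/r ≥ 0`, ns-ezl-w2's `integral_axialFlux_nonneg`, + transport) with its clause `hN` supplied by `ledgerBound_of_mirrorOutgoingWith`.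
This is literally the hypothesis `hM1` of ns-ezl-w2's member corollary `mirrorOutgoing_ae_eq_zero_of_momentMonotone` (`…MirrorMomentMember`).
Not NS regularity, not the crux E (19832 OPEN). [cite: ChoiJeong2025, Lemma 3.3 (time-reversed); cite: MajdaBertozziCUP2002, §2.3.3] -/
theorem momentMonotone_of_mirrorOutgoingWith :
    ∀ (u : ℝ → EuclideanSpace ℝ (Fin 3) → EuclideanSpace ℝ (Fin 3)) (p : ℝ → EuclideanSpace ℝ (Fin 3) → ℝ) (R₀ β : ℝ),
      (IsClassicalEulerSolutionOn (Set.Iio 0) 0 u p ∧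
        (∀ τ : ℝ, τ < 0 → IsAxisymmetric (u τ) ∧ HasNoSwirl (u τ)) ∧
        (∀ τ : ℝ, τ < 0 → ∀ x : EuclideanSpace ℝ (Fin 3),
          u τ (x - (2 * x 2) • (eZ : EuclideanSpace ℝ (Fin 3))) = u τ x - (2 * u τ x 2) • (eZ : EuclideanSpace ℝ (Fin 3))) ∧
        (∀ τ : ℝ, τ < 0 → ∀ x : EuclideanSpace ℝ (Fin 3), 0 ≤ x 2 * swirl (curl (u τ)) x) ∧
        0 ≤ R₀ ∧ 0 ≤ β ∧
        (∀ τ : ℝ, τ < 0 → ∀ x : EuclideanSpace ℝ (Fin 3), R₀ * (1 + -τ) ^ β < cylRadius x → curl (u τ) x = 0) ∧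
        (∀ τ : ℝ, τ < 0 →
          Integrable (fun x : EuclideanSpace ℝ (Fin 3) => (1 + ‖x‖) * ‖u τ x‖ ^ 2) ∧
            Integrable (fun x : EuclideanSpace ℝ (Fin 3) => (1 + ‖x‖) * (‖curl (u τ) x‖ / cylRadius x))) ∧
        (∀ T T' : ℝ, T ≤ T' → T' < 0 → ∃ B : ℝ, ∀ τ ∈ Set.Icc T T', ∀ x : EuclideanSpace ℝ (Fin 3), ‖u τ x‖ ≤ B)) →
      ∀ τ₁ τ₂ : ℝ, τ₁ ≤ τ₂ → τ₂ < 0 →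
        ∫ x, |x 2| * (‖curl (u τ₁) x‖ / cylRadius x) ≤ ∫ x, |x 2| * (‖curl (u τ₂) x‖ / cylRadius x) :=
  fun u p R₀ β h => momentMonotone_of_mirrorOutgoingWith_of_ledgerBound u p R₀ β h (ledgerBound_of_mirrorOutgoingWith u p R₀ β h)

end Summit.NavierStokesRegularity.NavierStokesRegularity.Theorems.PowerGaugeEulerLiouville.MirrorMoment

end
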